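import Mathlib
import Summits.NavierStokesRegularity.NavierStokesRegularity.Theorems.EulerZoomLiouvillePowerGaugeEulerLiouvilleDSSEndpointShell
import Summits.NavierStokesRegularity.NavierStokesRegularity.Theorems.EulerZoomLiouvillePowerGaugeEulerLiouvilleDSSEndpointPeriodFlux
import Summits.NavierStokesRegularity.NavierStokesRegularity.Theorems.EulerZoomLiouvillePowerGaugeEulerLiouvilleSelfSimilarEndpointLiouville
import HarnessLib

/-!
# Rung C2 of the crux `EulerZoomLiouville.PowerGaugeEulerLiouville` at the endpoint `ρ = 1/2`:
# period-energy drain of DISCRETELY self-similar members with sublinear far field (weak class)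

Route №10 `EulerZoomLiouville` (NavierStokesRegularity), crux E = stmt-NavierStokesRegularity-19832,
tenure rung C2 (`Sig.rungC2_dss`) at the energy-conserving endpoint `ρ = 1/2`.  For a suitable weak
Euler pair `(u, p)` on the slab, discretely self-similar with factor `l ≥ 4`
(`u(τ,y) = l^{3/2} u(l^{5/2}τ, l y)`, `p(τ,y) = l³ p(l^{5/2}τ, l y)`), with finite-energy slices
(`∫ |u(τ)|² ≤ E₀`), `|u(τ)|³, |p(τ)||u(τ)| ∈ L¹_loc`, the Riesz representation of `p(τ)` at large
scales and the sublinear far-field bound `|u(τ, y)| ≤ C_up |y|^{1−δ}` (`|y| ≥ R₀`) for a.e. slice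
of one period `I₀ = (l^{5/2} τ₀, τ₀)`:

* `dss_half_periodEnergy_decay` — the PERIOD-INTEGRATED shell energies drain at Shvydkoy's rate:
  `∫_{I₀} ∫_{L ≤ |y| < 2L} |u(τ)|² dτ ≤ C_ε L^{−5+ε}` (`L ≥ 1`).  This is the DSS form of the
  lineage's `shell_energy_decay_half` and of Xue's Thm 1.1 (ii) (arXiv:1408.6619, there for
  `C¹_s C³_y` profiles with the Riesz pressure ASSUMED), here inside Seregin's weak class: the
  period-integrated shell inequality (`dss_half_periodShell_le`), the lineage's one-slice
  cubic/pressure shell bounds (`exists_shell_flux_consts`) integrated over the period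
  (Cauchy–Schwarz `integral_sqrt_le`, dyadic window of width `2^m ≥ 4l`), and the real-variable
  iteration `shell_decay_of_recursion`.
* `dss_half_period_false_of_powerSpread` — with, in addition, a lower power bound
  `c₀ |y|^{−(4−δ')} ≤ |u(τ, y)|` (a.e. slice of the period, `|y| ≥ R₀'`): contradiction — no such
  member (Chae–Shvydkoy's Thm 3.1 for DISCRETELY self-similar collapse).

WHAT THIS IS NOT: not NS, not E, not rung C2 — one DSS endpoint stratum under power-spread
hypotheses; the DSS endpoint without a lower bound is as open as the self-similar one.
-/

noncomputable section

-- flat `Theorems/<Route><Decl>…` files of one crux share the namespace of the crux (tree convention)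
set_option linter.dupNamespace false

open MeasureTheory Set Filter Topology Metric Function TopologicalSpace Finset
open scoped ENNReal NNReal InnerProductSpace RealInnerProductSpace

namespace Summit.NavierStokesRegularity.NavierStokesRegularity.Theorems.PowerGaugeEulerLiouville

open Literature.Analysis Literature.Analysis.FunctionSpaces Literature.Analysis.FluidPDE

section Decay

variable {u : ℝ → EuclideanSpace ℝ (Fin 3) → EuclideanSpace ℝ (Fin 3)}
  {p : ℝ → EuclideanSpace ℝ (Fin 3) → ℝ}

/-- Exponent bookkeeping: `(c L)^r / L = c^r L^{r−1}` (`c, L > 0`). [folklore] -/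
theorem mul_rpow_div_eq {c L r : ℝ} (hc : 0 < c) (hL : 0 < L) :
    (c * L) ^ r / L = c ^ r * L ^ (r - 1) := by
  rw [Real.mul_rpow hc.le hL.le, Real.rpow_sub_one hL.ne', mul_div_assoc]

/-- **Period-energy drain of DSS members at the endpoint (weak class).**  See the module
docstring. [cite: Xue2014DSSEuler, Thm 1.1 (ii); ChaeShvydkoy2013, §3.1 proof of Thm. 3.1] -/
theorem dss_half_periodEnergy_decay
    (hsw : IsSuitableWeakSolutionOn (slab (EuclideanSpace ℝ (Fin 3)) (Iio 0) isOpen_Iio) 0 0 u p)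
    {l : ℝ} (hl : 4 ≤ l)
    (hu : ∀ τ : ℝ, τ < 0 → ∀ y, u τ y = (l ^ (3 / 2 : ℝ)) • u (l ^ (5 / 2 : ℝ) * τ) (l • y))
    (hp : ∀ τ : ℝ, τ < 0 → ∀ y, p τ y = l ^ 3 * p (l ^ (5 / 2 : ℝ) * τ) (l • y))
    {τ₀ : ℝ} (hτ₀ : τ₀ < 0) {E₀ : ℝ}
    (hE : ∀ᵐ τ : ℝ, τ < 0 → Integrable (fun y => ‖u τ y‖ ^ 2) volume ∧ ∫ y, ‖u τ y‖ ^ 2 ≤ E₀)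
    (h3 : ∀ᵐ τ : ℝ, τ < 0 → LocallyIntegrable (fun y => ‖u τ y‖ ^ 3) volume)
    (hPV : ∀ᵐ τ : ℝ, τ < 0 → LocallyIntegrable (fun y => |p τ y| * ‖u τ y‖) volume)
    {δ Cup R₀ : ℝ} (hδ : 0 < δ) (hδ1 : δ ≤ 1) (hCup : 0 ≤ Cup)
    (hup : ∀ᵐ τ : ℝ, τ ∈ Ioo (l ^ (5 / 2 : ℝ) * τ₀) τ₀ →
      ∀ᵐ y ∂volume, R₀ ≤ ‖y‖ → ‖u τ y‖ ≤ Cup * ‖y‖ ^ (1 - δ))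
    {R₁ : ℝ}
    (hPR : ∀ᵐ τ : ℝ, τ ∈ Ioo (l ^ (5 / 2 : ℝ) * τ₀) τ₀ → ∀ R : ℝ, R₁ ≤ R →
      ∀ᵐ y ∂volume, ‖y‖ < R / 2 →
        p τ y = rieszPressure ((ball (0 : EuclideanSpace ℝ (Fin 3)) R).indicator (u τ)) y +
          ∫ z in {z | R ≤ ‖z‖}, pressureKernel (y - z) (u τ z))
    {ε : ℝ} (hε : 0 < ε) :
    ∃ C : ℝ, ∀ L : ℝ, 1 ≤ L →
      ∫ τ in Ioo (l ^ (5 / 2 : ℝ) * τ₀) τ₀,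
          ∫ y in {y : EuclideanSpace ℝ (Fin 3) | L ≤ ‖y‖ ∧ ‖y‖ < 2 * L}, ‖u τ y‖ ^ 2 ≤
        C * L ^ (-(5 : ℝ) + ε) := by
  -- constants of the member and the period
  have hl0 : 0 < l := by linarith
  have hl1 : 1 < l := by linarith
  set b : ℝ := l ^ (5 / 2 : ℝ) with hb
  have hb1 : 1 < b := Real.one_lt_rpow hl1 (by norm_num)
  have hbτ : b * τ₀ < τ₀ := by nlinarith
  set I₀ : Set ℝ := Ioo (b * τ₀) τ₀ with hI₀
  set T : ℝ := τ₀ - b * τ₀ with hT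
  have hT0 : 0 < T := by rw [hT]; linarith
  have hTvol : volume.real I₀ = T := Real.volume_real_Ioo_of_le hbτ.le
  have hI₀0 : I₀ ⊆ Iio 0 := fun t ht => ht.2.trans hτ₀
  -- the window width `m`: `2^m ≥ 4l`, `m ≥ 5`
  obtain ⟨m₀, hm₀⟩ := pow_unbounded_of_one_lt (4 * l) (by norm_num : (1 : ℝ) < 2)
  set m : ℕ := m₀ + 5 with hm
  have h2m : 4 * l ≤ (2 : ℝ) ^ m := by
    rw [hm, pow_add]
    have : (1 : ℝ) ≤ 2 ^ 5 := by norm_num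
    nlinarith [hm₀, pow_pos (show (0 : ℝ) < 2 by norm_num) m₀]
  have h2m' : (64 : ℝ) ≤ 2 ^ (m + 1) := by
    rw [hm, show m₀ + 5 + 1 = m₀ + 6 by ring, pow_add]
    have : (1 : ℝ) ≤ 2 ^ m₀ := one_le_pow₀ (by norm_num)
    nlinarith
  -- the inputs: shell inequality, period flux bounds, slice energies
  obtain ⟨K, hK0, hK⟩ := dss_half_periodShell_le hsw (by linarith : (2 : ℝ) ≤ l) hu hp hτ₀
  obtain ⟨a, bb, ha0, hbb0, hQ⟩ := period_flux_le hsw hτ₀ hbτ hE h3 hPV hδ1 hCup hup hPR m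
  have hum : AEStronglyMeasurable (uncurry u)
      (volume.restrict (Iio (0 : ℝ) ×ˢ (univ : Set (EuclideanSpace ℝ (Fin 3))))) := by
    obtain ⟨G, hG, -, -⟩ := hsw.localEnergy
    simpa [slab] using hG.locallyIntegrableOn.aestronglyMeasurable
  have hW := fun (A : Set (EuclideanSpace ℝ (Fin 3))) (hA : MeasurableSet A) =>
    period_sliceSetEnergy hum hE (α := b * τ₀) hτ₀ hA
  -- `E₀ ≥ 0`
  have hE₀ : 0 ≤ E₀ := by
    have hne : (ae ((volume : Measure ℝ).restrict I₀)).NeBot := by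
      rw [ae_neBot, Ne, Measure.restrict_eq_zero, Real.volume_Ioo, ENNReal.ofReal_eq_zero, not_le]
      linarith
    obtain ⟨τ, hτ, hτI⟩ := ((ae_restrict_of_ae hE : ∀ᵐ τ ∂(volume.restrict I₀), _).and
      (ae_restrict_mem measurableSet_Ioo)).exists
    exact (integral_nonneg fun y => by positivity).trans (hτ (hI₀0 hτI)).2
  -- the shell energies `f` and the window sum `S`
  set f : ℝ → ℝ := fun L => ∫ τ in I₀, ∫ y in {y : EuclideanSpace ℝ (Fin 3) | L ≤ ‖y‖ ∧ ‖y‖ < 2 * L},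
    ‖u τ y‖ ^ 2 with hf
  set S : ℝ → ℝ := fun L => ∑ k ∈ range (2 * m + 1), f (2 ^ k * L / 2 ^ m) with hS
  have hshellm : ∀ A B : ℝ, MeasurableSet {y : EuclideanSpace ℝ (Fin 3) | A ≤ ‖y‖ ∧ ‖y‖ < B} :=
    fun A B => (measurableSet_le measurable_const measurable_norm).inter
      (measurableSet_lt measurable_norm measurable_const)
  have hshellm' : ∀ A B : ℝ, MeasurableSet {y : EuclideanSpace ℝ (Fin 3) | A ≤ ‖y‖ ∧ ‖y‖ ≤ B} :=
    fun A B => (measurableSet_le measurable_const measurable_norm).inter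
      (measurableSet_le measurable_norm measurable_const)
  have hf0 : ∀ L, 0 < L → 0 ≤ f L := fun L _ => (hW _ (hshellm L (2 * L))).2.2
  have hfB : ∀ L, 0 < L → f L ≤ T * E₀ := by
    intro L _
    obtain ⟨hi, hb2, -⟩ := hW _ (hshellm L (2 * L))
    calc f L ≤ ∫ τ in I₀, E₀ := setIntegral_mono_ae_restrict hi (integrable_const _)
          ((ae_restrict_iff' measurableSet_Ioo).2 (by
            filter_upwards [hb2] with τ hτ hτI; exact (hτ hτI).2))
      _ = T * E₀ := by rw [setIntegral_const, hTvol, smul_eq_mul]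
  -- the recursion
  set C₁ : ℝ := K / 2 * a * ((2 : ℝ) ^ (1 - δ) + l * (2 / l) ^ (1 - δ)) with hC₁
  set C₂ : ℝ := K / 2 * bb * E₀ * Real.sqrt T * ((2 : ℝ) ^ (-(3 / 2 : ℝ)) + l * (2 / l) ^ (-(3 / 2 : ℝ)))
    with hC₂
  have hC₁0 : 0 ≤ C₁ := by positivity
  have hC₂0 : 0 ≤ C₂ := by positivity
  set L₁ : ℝ := max 1 (max (4 * l * |R₀|) (l * |R₁|)) with hL₁
  have hL₁1 : 1 ≤ L₁ := le_max_left _ _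
  have hrec : ∀ L, L₁ ≤ L →
      f L ≤ C₁ * L ^ (-δ) * S L + C₂ * Real.sqrt (S L) * L ^ (-(5 / 2 : ℝ)) := by
    intro L hLL
    have hL1 : 1 ≤ L := hL₁1.trans hLL
    have hL : 0 < L := by linarith
    have hR₀L : 4 * l * |R₀| ≤ L := (le_max_left _ _).trans ((le_max_right _ _).trans hLL)
    have hR₁L : l * |R₁| ≤ L := (le_max_right _ _).trans ((le_max_right _ _).trans hLL)
    have hR₀a := le_abs_self R₀
    have hR₁a := le_abs_self R₁
    have hSL0 : 0 ≤ S L := windowSum_nonneg hf0 (fun L => rfl) hL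
    -- (i) the target shell sits in the shell of the period inequality at scale `2L`
    have h1 : f L ≤ ∫ τ in I₀,
        ∫ y in {y : EuclideanSpace ℝ (Fin 3) | 2 * (2 * L) / l ≤ ‖y‖ ∧ ‖y‖ ≤ 2 * L}, ‖u τ y‖ ^ 2 := by
      obtain ⟨hiA, -, -⟩ := hW _ (hshellm' (2 * (2 * L) / l) (2 * L))
      obtain ⟨hif, -, -⟩ := hW _ (hshellm L (2 * L))
      refine setIntegral_mono_ae_restrict hif hiA ((ae_restrict_iff' measurableSet_Ioo).2 ?_)
      filter_upwards [hE] with τ hτ hτI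
      obtain ⟨hi2, -⟩ := hτ (hI₀0 hτI)
      have h4 : 2 * (2 * L) / l ≤ L := by
        rw [div_le_iff₀ hl0]
        have := mul_le_mul_of_nonneg_left hl hL.le
        linarith
      exact setIntegral_mono_set hi2.integrableOn (Eventually.of_forall fun y => by positivity)
        (Eventually.of_forall fun y hy => ⟨h4.trans hy.1, hy.2.le⟩)
    -- (ii) the period inequality at scale `2L` and the two flux bounds
    have h2 := hK (2 * L) (by positivity)
    have h4m : (4 : ℝ) ≤ 2 ^ m := by linarith [h2m]
    have hR₀' : 16 * |R₀| ≤ 4 * l * |R₀| :=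
      mul_le_mul_of_nonneg_right (by linarith) (abs_nonneg R₀)
    have hR₁' : 1 * |R₁| ≤ l * |R₁| := mul_le_mul_of_nonneg_right hl1.le (abs_nonneg R₁)
    have h64 : 64 * L ≤ 2 ^ (m + 1) * L := mul_le_mul_of_nonneg_right h2m' hL.le
    have h64' : 2 ^ (m + 1) * L ≤ 2 ^ (m + 1) * L * l := le_mul_of_one_le_right (by positivity) hl1.le
    have c1 : R₀ ≤ 2 * L / 8 := by linarith
    have c2 : R₁ ≤ 32 * (2 * L) := by linarith
    have c3 : L / 2 ^ m ≤ 2 * L / 8 := by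
      rw [show 2 * L / 8 = L / 4 by ring]; exact div_le_div_of_nonneg_left hL.le (by norm_num) h4m
    have c4 : 32 * (2 * L) ≤ 2 ^ (m + 1) * L := by linarith
    have hX₁ := hQ L (2 * L) hL (by positivity) c1 c2 c3 c4
    have d1 : R₀ ≤ 2 * L / l / 8 := by
      rw [show 2 * L / l / 8 = L / (4 * l) by ring, le_div_iff₀ (by positivity)]
      have := mul_le_mul_of_nonneg_right hR₀a (by positivity : (0 : ℝ) ≤ 4 * l)
      linarith
    have d2 : R₁ ≤ 32 * (2 * L / l) := by
      rw [show 32 * (2 * L / l) = 64 * L / l by ring, le_div_iff₀ hl0]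
      have := mul_le_mul_of_nonneg_right hR₁a hl0.le
      linarith
    have d3 : L / 2 ^ m ≤ 2 * L / l / 8 := by
      rw [show 2 * L / l / 8 = L / (4 * l) by ring]
      exact div_le_div_of_nonneg_left hL.le (by positivity) h2m
    have d4 : 32 * (2 * L / l) ≤ 2 ^ (m + 1) * L := by
      rw [show 32 * (2 * L / l) = 64 * L / l by ring, div_le_iff₀ hl0]
      linarith
    have hX₂ := hQ L (2 * L / l) hL (by positivity) d1 d2 d3 d4
    have hset : {y : EuclideanSpace ℝ (Fin 3) | 2 * L / l ≤ ‖y‖ ∧ ‖y‖ ≤ 2 * (2 * L) / l} =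
        {y : EuclideanSpace ℝ (Fin 3) | 2 * L / l ≤ ‖y‖ ∧ ‖y‖ ≤ 2 * (2 * L / l)} := by
      ext y; simp only [mem_setOf_eq, mul_div_assoc]
    rw [hset] at h2
    -- exponent bookkeeping
    have hLδ : L ^ (1 - δ) = L ^ (-δ) * L := by
      rw [show (1 : ℝ) - δ = -δ + 1 by ring, Real.rpow_add_one hL.ne']
    have hL52 : L ^ (-(3 / 2 : ℝ)) = L ^ (-(5 / 2 : ℝ)) * L := by
      rw [show (-(3 / 2 : ℝ)) = -(5 / 2 : ℝ) + 1 by norm_num, Real.rpow_add_one hL.ne']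
    have hr1 : (2 * L) ^ (1 - δ) = (2 : ℝ) ^ (1 - δ) * (L ^ (-δ) * L) := by
      rw [Real.mul_rpow (by norm_num) hL.le, hLδ]
    have hr2 : (2 * L / l) ^ (1 - δ) = (2 / l) ^ (1 - δ) * (L ^ (-δ) * L) := by
      rw [show 2 * L / l = 2 / l * L by ring, Real.mul_rpow (by positivity) hL.le, hLδ]
    have hr3 : (2 * L) ^ (-(3 / 2 : ℝ)) = (2 : ℝ) ^ (-(3 / 2 : ℝ)) * (L ^ (-(5 / 2 : ℝ)) * L) := by
      rw [Real.mul_rpow (by norm_num) hL.le, hL52]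
    have hr4 : (2 * L / l) ^ (-(3 / 2 : ℝ)) = (2 / l) ^ (-(3 / 2 : ℝ)) * (L ^ (-(5 / 2 : ℝ)) * L) := by
      rw [show 2 * L / l = 2 / l * L by ring, Real.mul_rpow (by positivity) hL.le, hL52]
    have hsq : Real.sqrt (T * S L) = Real.sqrt T * Real.sqrt (S L) := Real.sqrt_mul hT0.le _
    calc f L ≤ _ := h1
      _ ≤ _ := h2
      _ ≤ K / (2 * L) * ((a * (2 * L) ^ (1 - δ) * S L +
              bb * (2 * L) ^ (-(3 / 2 : ℝ)) * E₀ * Real.sqrt (T * S L)) +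
            l * (a * (2 * L / l) ^ (1 - δ) * S L +
              bb * (2 * L / l) ^ (-(3 / 2 : ℝ)) * E₀ * Real.sqrt (T * S L))) :=
          mul_le_mul_of_nonneg_left (add_le_add hX₁ (mul_le_mul_of_nonneg_left hX₂ hl0.le))
            (by positivity)
      _ = C₁ * L ^ (-δ) * S L + C₂ * Real.sqrt (S L) * L ^ (-(5 / 2 : ℝ)) := by
          rw [hr1, hr2, hr3, hr4, hsq, hC₁, hC₂]
          field_simp
          ring
  -- iterate
  obtain ⟨C, hC⟩ := shell_decay_of_recursion (κ := 5 / 2) hf0 hfB hδ hC₁0 hC₂0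
    (lt_of_lt_of_le one_pos hL₁1) (fun L => rfl) hrec hε
  refine ⟨C, fun L hL => ?_⟩
  have := hC L hL
  norm_num at this ⊢
  exact this

/-- **No DSS member with power spread at the endpoint (period form).**  Under the hypotheses of
`dss_half_periodEnergy_decay` and, in addition, a LOWER power bound `c₀ |y|^{−(4−δ')} ≤ |u(τ, y)|`
(`|y| ≥ R₀'`, `0 < δ' ≤ 4`) for a.e. slice of the period: contradiction — the period-integrated shell
energies would be `≳ L^{−5+2δ'}` and `≲ L^{−5+δ'}` at once (Chae–Shvydkoy's Thm 3.1 for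
DISCRETELY self-similar collapse, weak class). [cite: ChaeShvydkoy2013, §3.1 Thm. 3.1] -/
theorem dss_half_period_false_of_powerSpread
    (hsw : IsSuitableWeakSolutionOn (slab (EuclideanSpace ℝ (Fin 3)) (Iio 0) isOpen_Iio) 0 0 u p)
    {l : ℝ} (hl : 4 ≤ l)
    (hu : ∀ τ : ℝ, τ < 0 → ∀ y, u τ y = (l ^ (3 / 2 : ℝ)) • u (l ^ (5 / 2 : ℝ) * τ) (l • y))
    (hp : ∀ τ : ℝ, τ < 0 → ∀ y, p τ y = l ^ 3 * p (l ^ (5 / 2 : ℝ) * τ) (l • y))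
    {τ₀ : ℝ} (hτ₀ : τ₀ < 0) {E₀ : ℝ}
    (hE : ∀ᵐ τ : ℝ, τ < 0 → Integrable (fun y => ‖u τ y‖ ^ 2) volume ∧ ∫ y, ‖u τ y‖ ^ 2 ≤ E₀)
    (h3 : ∀ᵐ τ : ℝ, τ < 0 → LocallyIntegrable (fun y => ‖u τ y‖ ^ 3) volume)
    (hPV : ∀ᵐ τ : ℝ, τ < 0 → LocallyIntegrable (fun y => |p τ y| * ‖u τ y‖) volume)
    {δ Cup R₀ : ℝ} (hδ : 0 < δ) (hδ1 : δ ≤ 1) (hCup : 0 ≤ Cup)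
    (hup : ∀ᵐ τ : ℝ, τ ∈ Ioo (l ^ (5 / 2 : ℝ) * τ₀) τ₀ →
      ∀ᵐ y ∂volume, R₀ ≤ ‖y‖ → ‖u τ y‖ ≤ Cup * ‖y‖ ^ (1 - δ))
    {R₁ : ℝ}
    (hPR : ∀ᵐ τ : ℝ, τ ∈ Ioo (l ^ (5 / 2 : ℝ) * τ₀) τ₀ → ∀ R : ℝ, R₁ ≤ R →
      ∀ᵐ y ∂volume, ‖y‖ < R / 2 →
        p τ y = rieszPressure ((ball (0 : EuclideanSpace ℝ (Fin 3)) R).indicator (u τ)) y +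
          ∫ z in {z | R ≤ ‖z‖}, pressureKernel (y - z) (u τ z))
    {c₀ δ' R₀' : ℝ} (hc₀ : 0 < c₀) (hδ' : 0 < δ') (hδ'4 : δ' ≤ 4)
    (hlow : ∀ᵐ τ : ℝ, τ ∈ Ioo (l ^ (5 / 2 : ℝ) * τ₀) τ₀ →
      ∀ᵐ y ∂volume, R₀' ≤ ‖y‖ → c₀ * ‖y‖ ^ (-(4 - δ')) ≤ ‖u τ y‖) : False := by
  obtain ⟨C, hC⟩ := dss_half_periodEnergy_decay hsw hl hu hp hτ₀ hE h3 hPV hδ hδ1 hCup hup hPR hδ'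
  have hl1 : 1 < l := by linarith
  set b : ℝ := l ^ (5 / 2 : ℝ) with hb
  have hb1 : 1 < b := Real.one_lt_rpow hl1 (by norm_num)
  have hbτ : b * τ₀ < τ₀ := by nlinarith
  set T : ℝ := τ₀ - b * τ₀ with hT
  have hT0 : 0 < T := by rw [hT]; linarith
  have hI0 : Ioo (b * τ₀) τ₀ ⊆ Iio 0 := fun t ht => ht.2.trans hτ₀
  have hum : AEStronglyMeasurable (uncurry u)
      (volume.restrict (Iio (0 : ℝ) ×ˢ (univ : Set (EuclideanSpace ℝ (Fin 3))))) := by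
    obtain ⟨G, hG, -, -⟩ := hsw.localEnergy
    simpa [slab] using hG.locallyIntegrableOn.aestronglyMeasurable
  have hv : 0 < volume.real (ball (0 : EuclideanSpace ℝ (Fin 3)) 1) := by
    rw [measureReal_def]
    exact ENNReal.toReal_pos (measure_ball_pos volume 0 one_pos).ne' measure_ball_lt_top.ne
  set c' : ℝ := c₀ ^ 2 * (2 : ℝ) ^ (-(8 - 2 * δ')) * (1 / 4) ^ 3 *
    volume.real (ball (0 : EuclideanSpace ℝ (Fin 3)) 1) with hc'
  have hc'0 : 0 < c' := by positivity
  -- the lower bound on the period-integrated shell energies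
  have hlowf : ∀ L, max R₀' 1 ≤ L → T * c' * L ^ (-(5 : ℝ) + 2 * δ') ≤
      ∫ τ in Ioo (b * τ₀) τ₀, ∫ y in {y : EuclideanSpace ℝ (Fin 3) | L ≤ ‖y‖ ∧ ‖y‖ < 2 * L},
        ‖u τ y‖ ^ 2 := by
    intro L hL
    obtain ⟨hif, -, -⟩ := period_sliceSetEnergy hum hE (α := b * τ₀) hτ₀
      ((measurableSet_le measurable_const measurable_norm).inter
        (measurableSet_lt measurable_norm measurable_const) :
        MeasurableSet {y : EuclideanSpace ℝ (Fin 3) | L ≤ ‖y‖ ∧ ‖y‖ < 2 * L})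
    have hpt : ∀ᵐ τ : ℝ, τ ∈ Ioo (b * τ₀) τ₀ → c' * L ^ (-(5 : ℝ) + 2 * δ') ≤
        ∫ y in {y : EuclideanSpace ℝ (Fin 3) | L ≤ ‖y‖ ∧ ‖y‖ < 2 * L}, ‖u τ y‖ ^ 2 := by
      filter_upwards [hE, hlow] with τ hEτ hlτ hτI
      exact shell_energy_lower_of_powerLower (hEτ (hI0 hτI)).1 hc₀ hδ'4 (hlτ hτI) hL
    calc T * c' * L ^ (-(5 : ℝ) + 2 * δ')
        = ∫ τ in Ioo (b * τ₀) τ₀, c' * L ^ (-(5 : ℝ) + 2 * δ') := by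
          rw [setIntegral_const, Real.volume_real_Ioo_of_le hbτ.le, smul_eq_mul, hT]; ring
      _ ≤ _ := setIntegral_mono_ae_restrict (integrable_const _) hif
          ((ae_restrict_iff' measurableSet_Ioo).2 hpt)
  -- for large `L` the two bounds are incompatible
  have hev : ∀ᶠ L : ℝ in atTop, C / (T * c') < L ^ δ' ∧ max R₀' 1 ≤ L :=
    ((tendsto_rpow_atTop hδ').eventually_gt_atTop _).and (eventually_ge_atTop _)
  obtain ⟨L, hL1, hL2⟩ := hev.exists
  have hL1' : 1 ≤ L := (le_max_right _ _).trans hL2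
  have hL0 : 0 < L := by linarith
  have h1 := (hlowf L hL2).trans (hC L hL1')
  have h2 : T * c' * L ^ δ' ≤ C := by
    have h3 := mul_le_mul_of_nonneg_right h1 (Real.rpow_pos_of_pos hL0 (5 - δ')).le
    have e1 : L ^ (-(5 : ℝ) + 2 * δ') * L ^ (5 - δ') = L ^ δ' := by
      rw [← Real.rpow_add hL0]; congr 1; ring
    have e2 : L ^ (-(5 : ℝ) + δ') * L ^ (5 - δ') = 1 := by
      rw [← Real.rpow_add hL0, show -(5 : ℝ) + δ' + (5 - δ') = 0 by ring, Real.rpow_zero]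
    calc T * c' * L ^ δ' = T * c' * L ^ (-(5 : ℝ) + 2 * δ') * L ^ (5 - δ') := by
          rw [mul_assoc (T * c'), e1]
      _ ≤ C * L ^ (-(5 : ℝ) + δ') * L ^ (5 - δ') := h3
      _ = C := by rw [mul_assoc, e2, mul_one]
  rw [div_lt_iff₀ (by positivity)] at hL1
  nlinarith [h2, hL1]

end Decay

end Summit.NavierStokesRegularity.NavierStokesRegularity.Theorems.PowerGaugeEulerLiouville
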